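import Summits.Ventures.QEC.Thresholds.BBDepolarizingBounds
import Summits.Ventures.QEC.Theorems.BB90DistanceCertificateTarget
import Summits.Ventures.QEC.Theorems.BB108DistanceCertificateTarget
import HarnessLib

/-!
# Depolarizing logical-error bounds for EVERY bivariate-bicycle census row `HasParams C n k d`, and the rows
# `[[90,8,10]]`, `[[108,8,10]]` (UNCONDITIONAL, kernel) and `[[288,12,18]]` (given its claim)

Venture QEC, `Summits/Ventures/QEC/Thresholds/` (LADDER-QEC rung Q5 × Q2, PARTITION row 09 "noise models: i.i.d.
depolarising"; qec-type-09 gen 3). Companion of `BBDepolarizingBounds.lean` (`[[72,12,6]]`, `[[144,12,12]]`):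

* `bb_depolarizingFailureProb_le_of_hasParams` — the GENERIC census interface: for every bivariate-bicycle code
  `QC(A,B)` (`IsBBPoly`: `A`, `B` sums of three monomials, checks of weight `6`) and every census row
  `HasParams C n k d` (`d ≥ 1`), every pair of minimum-weight decoders (`DX` on bit flips, `DZ` on phase flips),
  every `0 ≤ p ≤ 3/4` with `10√(q(1-q)) < 1`, `q = 2p/3`:
  `P^depol_fail(p) ≤ 2·(n·(10√(q(1-q)))^d / (5(1-10√(q(1-q)))))` — the depolarizing union bound
  (`CSSCode.depolarizingFailureProb_le`: both marginals are independent flips of rate `2p/3`) over qec-lit-2's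
  per-sector census interface `bb_z|xFailureProb_le_of_hasParams` (`BBFiniteSizeBounds.lean`);
* `bb90_depolarizingFailureProb_le(_poly)` — `[[90,8,10]]` (`BB90_8_10_claim_holds`, route BB90DistanceCertificate,
  KERNEL): `≤ 2·90·(100q(1-q))⁵/(5(1-10√(q(1-q))))`, and `≤ 72·(100q(1-q))⁵` when `100q(1-q) ≤ 1/4`;
* `bb108_depolarizingFailureProb_le(_poly)` — `[[108,8,10]]` (`BB108_8_10_claim_holds`, KERNEL-std):
  `≤ 86.4·(100q(1-q))⁵` when `100q(1-q) ≤ 1/4`;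
* `bb288_depolarizingFailureProb_le_of_claim` — `[[288,12,18]]` GIVEN `BB288_12_18_claim` (COMPUTED-B in the census,
  no kernel certificate; hypothesis `h`): `≤ 2·288·(100q(1-q))⁹/(5(1-10√(q(1-q))))`.

HONEST FRAMING: rigorous UPPER bounds for sector-wise (correlation-blind) minimum-weight decoding, kernel axioms, no
named fact, no `native_decide`; `[[288,12,18]]` is conditional on its printed claim; not comparable with Monte Carlo
BP-OSD numbers (VALIDATED column).

## References

* [DumerKovalevPryadko2015] I. Dumer, A. A. Kovalev, L. P. Pryadko, PRL 115 (2015) 050502, Thm 2, eq.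
  (succesful-decoding-depolarizing).
* [BravyiEtAl2024] S. Bravyi et al., Nature 627 (2024) 778, Table 1 (`[[90,8,10]]`, `[[108,8,10]]`, `[[288,12,18]]`).
-/

noncomputable section

namespace Summit.Ventures.QEC.Thresholds

open Finset Matrix
open Literature.InformationTheory.QuantumCodes
open Summit.Ventures.QEC.BB Summit.Ventures.QEC.Census.BB90 Summit.Ventures.QEC.Census.BB108

/-! ### The generic census interface -/

/-- **Depolarizing bound for every BB census row**: `QC(A,B)` with `IsBBPoly A`, `IsBBPoly B`, `HasParams C n k d`,
`d ≥ 1`, sector-wise minimum-weight decoding, `0 ≤ p ≤ 3/4`, `10√(q(1-q)) < 1` (`q = 2p/3`):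
`P^depol_fail(p) ≤ 2·(n·(10√(q(1-q)))^d / (5(1-10√(q(1-q)))))`.
[cite: DumerKovalevPryadko2015, Thm 2 (w = 6) with eq. (succesful-decoding-depolarizing)] -/
theorem bb_depolarizingFailureProb_le_of_hasParams {ℓ m : ℕ} [NeZero ℓ] [NeZero m] (C : BB.Code ℓ m)
    (hA : BB.IsBBPoly C.A) (hB : BB.IsBBPoly C.B) {n k d : ℕ} (h : HasParams C n k d) (hd1 : 1 ≤ d)
    {DX DZ : Decoder (BB.Mono ℓ m → ZMod 2) (BB.Mono ℓ m ⊕ BB.Mono ℓ m → ZMod 2)}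
    (hDX : DX.IsMinWeight C.css.xSyndrome (C.css.kerZ : Set (BB.Mono ℓ m ⊕ BB.Mono ℓ m → ZMod 2)) hammingNorm)
    (hDZ : DZ.IsMinWeight C.css.zSyndrome (C.css.kerX : Set (BB.Mono ℓ m ⊕ BB.Mono ℓ m → ZMod 2)) hammingNorm)
    {p : ℝ} (hp0 : 0 ≤ p) (hp : p ≤ 3 / 4) (hr : 10 * Real.sqrt (2 * p / 3 * (1 - 2 * p / 3)) < 1) :
    C.css.depolarizingFailureProb DX DZ p ≤
      2 * ((n : ℝ) * (10 * Real.sqrt (2 * p / 3 * (1 - 2 * p / 3))) ^ d /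
        (5 * (1 - 10 * Real.sqrt (2 * p / 3 * (1 - 2 * p / 3))))) := by
  have hq0 : 0 ≤ 2 * p / 3 := by positivity
  have hq : 2 * p / 3 ≤ 1 / 2 := by linarith
  have h0 := C.css.depolarizingFailureProb_le DX DZ hp0 (by linarith)
  have hX := bb_xFailureProb_le_of_hasParams C hA hB h hd1 hDX hq0 hq hr
  have hZ := bb_zFailureProb_le_of_hasParams C hA hB h hd1 hDZ hq0 hq hr
  linarith

/-- The polynomial form: if `100q(1-q) ≤ 1/4` the tail factor `1/(1-10√(q(1-q)))` is `≤ 2`, and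
`(10√(q(1-q)))^{2j} = (100q(1-q))^j`. [folklore] -/
private theorem depol_poly_form {q N : ℝ} {j : ℕ} (hq0 : 0 ≤ q) (hq1 : q ≤ 1) (hN : 0 ≤ N)
    (hsmall : 100 * (q * (1 - q)) ≤ 1 / 4) :
    2 * (N * (10 * Real.sqrt (q * (1 - q))) ^ (2 * j) / (5 * (1 - 10 * Real.sqrt (q * (1 - q))))) ≤
      4 * N / 5 * (100 * (q * (1 - q))) ^ j := by
  have hqq : 0 ≤ q * (1 - q) := mul_nonneg hq0 (by linarith)
  have hpow : (10 * Real.sqrt (q * (1 - q))) ^ (2 * j) = (100 * (q * (1 - q))) ^ j := by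
    rw [pow_mul, mul_pow, Real.sq_sqrt hqq]
    norm_num
  have hs : 10 * Real.sqrt (q * (1 - q)) ≤ 1 / 2 := by
    have h1 : Real.sqrt (q * (1 - q)) ≤ Real.sqrt (1 / 400) := Real.sqrt_le_sqrt (by linarith)
    have h2 : Real.sqrt (1 / 400) = 1 / 20 := by
      rw [show (1 / 400 : ℝ) = (1 / 20) ^ 2 by norm_num, Real.sqrt_sq (by norm_num)]
    linarith
  rw [hpow]
  have hu : 0 ≤ N * (100 * (q * (1 - q))) ^ j := mul_nonneg hN (pow_nonneg (by positivity) j)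
  have hden : (5 : ℝ) / 2 ≤ 5 * (1 - 10 * Real.sqrt (q * (1 - q))) := by linarith
  have hdiv : N * (100 * (q * (1 - q))) ^ j / (5 * (1 - 10 * Real.sqrt (q * (1 - q)))) ≤
      N * (100 * (q * (1 - q))) ^ j / (5 / 2) :=
    div_le_div_of_nonneg_left hu (by norm_num) hden
  have : N * (100 * (q * (1 - q))) ^ j / (5 / 2) = 2 * N / 5 * (100 * (q * (1 - q))) ^ j := by ring
  linarith

/-! ### `[[90, 8, 10]]` — unconditional -/

/-- **`[[90,8,10]]` under depolarizing noise** (sector-wise minimum-weight decoding, any decoder pair):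
`P^depol_fail(p) ≤ 2·90·(10√(q(1-q)))¹⁰/(5(1-10√(q(1-q))))`, `q = 2p/3`. UNCONDITIONAL, kernel
(`BB90_8_10_claim_holds`). [cite: DumerKovalevPryadko2015, Thm 2 (w = 6)] [cite: BravyiEtAl2024, Table 1 ([[90,8,10]])] -/
theorem bb90_depolarizingFailureProb_le
    {DX DZ : Decoder (BB.Mono 15 3 → ZMod 2) (BB.Mono 15 3 ⊕ BB.Mono 15 3 → ZMod 2)}
    (hDX : DX.IsMinWeight BB.bb90.css.xSyndrome (BB.bb90.css.kerZ : Set (BB.Mono 15 3 ⊕ BB.Mono 15 3 → ZMod 2))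
      hammingNorm)
    (hDZ : DZ.IsMinWeight BB.bb90.css.zSyndrome (BB.bb90.css.kerX : Set (BB.Mono 15 3 ⊕ BB.Mono 15 3 → ZMod 2))
      hammingNorm)
    {p : ℝ} (hp0 : 0 ≤ p) (hp : p ≤ 3 / 4) (hr : 10 * Real.sqrt (2 * p / 3 * (1 - 2 * p / 3)) < 1) :
    BB.bb90.css.depolarizingFailureProb DX DZ p ≤
      2 * ((90 : ℕ) * (10 * Real.sqrt (2 * p / 3 * (1 - 2 * p / 3))) ^ 10 /
        (5 * (1 - 10 * Real.sqrt (2 * p / 3 * (1 - 2 * p / 3))))) :=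
  bb_depolarizingFailureProb_le_of_hasParams BB.bb90 BB.isBBPoly_bb90.1 BB.isBBPoly_bb90.2 BB90_8_10_claim_holds
    (by norm_num) hDX hDZ hp0 hp hr

/-- **`[[90,8,10]]`, polynomial form**: `100q(1-q) ≤ 1/4` (`q = 2p/3`) ⇒ `P^depol_fail(p) ≤ 72·(100q(1-q))⁵`
(e.g. `p = 10⁻³`: `≤ 9.5·10⁻⁵`). UNCONDITIONAL, kernel. [cite: DumerKovalevPryadko2015, Thm 2 (w = 6)] -/
theorem bb90_depolarizingFailureProb_le_poly
    {DX DZ : Decoder (BB.Mono 15 3 → ZMod 2) (BB.Mono 15 3 ⊕ BB.Mono 15 3 → ZMod 2)}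
    (hDX : DX.IsMinWeight BB.bb90.css.xSyndrome (BB.bb90.css.kerZ : Set (BB.Mono 15 3 ⊕ BB.Mono 15 3 → ZMod 2))
      hammingNorm)
    (hDZ : DZ.IsMinWeight BB.bb90.css.zSyndrome (BB.bb90.css.kerX : Set (BB.Mono 15 3 ⊕ BB.Mono 15 3 → ZMod 2))
      hammingNorm)
    {p : ℝ} (hp0 : 0 ≤ p) (hp : p ≤ 3 / 4) (hsmall : 100 * (2 * p / 3 * (1 - 2 * p / 3)) ≤ 1 / 4) :
    BB.bb90.css.depolarizingFailureProb DX DZ p ≤ 72 * (100 * (2 * p / 3 * (1 - 2 * p / 3))) ^ 5 := by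
  have hs : 10 * Real.sqrt (2 * p / 3 * (1 - 2 * p / 3)) ≤ 1 / 2 := by
    have h1 : Real.sqrt (2 * p / 3 * (1 - 2 * p / 3)) ≤ Real.sqrt (1 / 400) := Real.sqrt_le_sqrt (by linarith)
    have h2 : Real.sqrt (1 / 400) = 1 / 20 := by
      rw [show (1 / 400 : ℝ) = (1 / 20) ^ 2 by norm_num, Real.sqrt_sq (by norm_num)]
    linarith
  have h := bb90_depolarizingFailureProb_le hDX hDZ hp0 hp (by linarith)
  have hpoly := depol_poly_form (q := 2 * p / 3) (N := (90 : ℕ)) (j := 5) (by positivity) (by linarith)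
    (by positivity) hsmall
  rw [show 2 * 5 = 10 by norm_num] at hpoly
  refine h.trans (hpoly.trans (le_of_eq ?_))
  norm_num

/-- Non-vacuity: the canonical minimum-weight decoder pair of `[[90,8,10]]` qualifies.
[cite: DumerKovalevPryadko2015, p. 3 (exhaustive minimum-weight decoding)] -/
theorem bb90_depolarizingFailureProb_le_poly_minWeight {p : ℝ} (hp0 : 0 ≤ p) (hp : p ≤ 3 / 4)
    (hsmall : 100 * (2 * p / 3 * (1 - 2 * p / 3)) ≤ 1 / 4) :
    BB.bb90.css.depolarizingFailureProb (Decoder.minWeight BB.bb90.css.xSyndrome hammingNorm)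
        (Decoder.minWeight BB.bb90.css.zSyndrome hammingNorm) p ≤
      72 * (100 * (2 * p / 3 * (1 - 2 * p / 3))) ^ 5 :=
  bb90_depolarizingFailureProb_le_poly BB.bb90.css.isMinWeight_minWeight_xSyndrome
    BB.bb90.css.isMinWeight_minWeight_zSyndrome hp0 hp hsmall

/-! ### `[[108, 8, 10]]` — unconditional -/

/-- **`[[108,8,10]]` under depolarizing noise**: `P^depol_fail(p) ≤ 2·108·(10√(q(1-q)))¹⁰/(5(1-10√(q(1-q))))`,
`q = 2p/3`. UNCONDITIONAL, kernel (`BB108_8_10_claim_holds`).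
[cite: DumerKovalevPryadko2015, Thm 2 (w = 6)] [cite: BravyiEtAl2024, Table 1 ([[108,8,10]])] -/
theorem bb108_depolarizingFailureProb_le
    {DX DZ : Decoder (BB.Mono 9 6 → ZMod 2) (BB.Mono 9 6 ⊕ BB.Mono 9 6 → ZMod 2)}
    (hDX : DX.IsMinWeight BB.bb108.css.xSyndrome (BB.bb108.css.kerZ : Set (BB.Mono 9 6 ⊕ BB.Mono 9 6 → ZMod 2))
      hammingNorm)
    (hDZ : DZ.IsMinWeight BB.bb108.css.zSyndrome (BB.bb108.css.kerX : Set (BB.Mono 9 6 ⊕ BB.Mono 9 6 → ZMod 2))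
      hammingNorm)
    {p : ℝ} (hp0 : 0 ≤ p) (hp : p ≤ 3 / 4) (hr : 10 * Real.sqrt (2 * p / 3 * (1 - 2 * p / 3)) < 1) :
    BB.bb108.css.depolarizingFailureProb DX DZ p ≤
      2 * ((108 : ℕ) * (10 * Real.sqrt (2 * p / 3 * (1 - 2 * p / 3))) ^ 10 /
        (5 * (1 - 10 * Real.sqrt (2 * p / 3 * (1 - 2 * p / 3))))) :=
  bb_depolarizingFailureProb_le_of_hasParams BB.bb108 BB.isBBPoly_bb108.1 BB.isBBPoly_bb108.2
    BB108_8_10_claim_holds (by norm_num) hDX hDZ hp0 hp hr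

/-- **`[[108,8,10]]`, polynomial form**: `100q(1-q) ≤ 1/4` ⇒ `P^depol_fail(p) ≤ 86.4·(100q(1-q))⁵`.
UNCONDITIONAL, kernel. [cite: DumerKovalevPryadko2015, Thm 2 (w = 6)] -/
theorem bb108_depolarizingFailureProb_le_poly
    {DX DZ : Decoder (BB.Mono 9 6 → ZMod 2) (BB.Mono 9 6 ⊕ BB.Mono 9 6 → ZMod 2)}
    (hDX : DX.IsMinWeight BB.bb108.css.xSyndrome (BB.bb108.css.kerZ : Set (BB.Mono 9 6 ⊕ BB.Mono 9 6 → ZMod 2))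
      hammingNorm)
    (hDZ : DZ.IsMinWeight BB.bb108.css.zSyndrome (BB.bb108.css.kerX : Set (BB.Mono 9 6 ⊕ BB.Mono 9 6 → ZMod 2))
      hammingNorm)
    {p : ℝ} (hp0 : 0 ≤ p) (hp : p ≤ 3 / 4) (hsmall : 100 * (2 * p / 3 * (1 - 2 * p / 3)) ≤ 1 / 4) :
    BB.bb108.css.depolarizingFailureProb DX DZ p ≤ 86.4 * (100 * (2 * p / 3 * (1 - 2 * p / 3))) ^ 5 := by
  have hs : 10 * Real.sqrt (2 * p / 3 * (1 - 2 * p / 3)) ≤ 1 / 2 := by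
    have h1 : Real.sqrt (2 * p / 3 * (1 - 2 * p / 3)) ≤ Real.sqrt (1 / 400) := Real.sqrt_le_sqrt (by linarith)
    have h2 : Real.sqrt (1 / 400) = 1 / 20 := by
      rw [show (1 / 400 : ℝ) = (1 / 20) ^ 2 by norm_num, Real.sqrt_sq (by norm_num)]
    linarith
  have h := bb108_depolarizingFailureProb_le hDX hDZ hp0 hp (by linarith)
  have hpoly := depol_poly_form (q := 2 * p / 3) (N := (108 : ℕ)) (j := 5) (by positivity) (by linarith)
    (by positivity) hsmall
  rw [show 2 * 5 = 10 by norm_num] at hpoly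
  refine h.trans (hpoly.trans (le_of_eq ?_))
  norm_num

/-! ### `[[288, 12, 18]]` — given its printed claim -/

/-- **`[[288,12,18]]` under depolarizing noise, GIVEN `BB288_12_18_claim`** (the census holds this distance at tier
COMPUTED-B only — no kernel certificate — so the claim enters as a hypothesis `h`):
`P^depol_fail(p) ≤ 2·288·(10√(q(1-q)))¹⁸/(5(1-10√(q(1-q))))`, `q = 2p/3`.
[cite: DumerKovalevPryadko2015, Thm 2 (w = 6)] [cite: BravyiEtAl2024, Table 1 ([[288,12,18]])] -/
theorem bb288_depolarizingFailureProb_le_of_claim (h : BB288_12_18_claim)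
    {DX DZ : Decoder (BB.Mono 12 12 → ZMod 2) (BB.Mono 12 12 ⊕ BB.Mono 12 12 → ZMod 2)}
    (hDX : DX.IsMinWeight BB.bb288.css.xSyndrome
      (BB.bb288.css.kerZ : Set (BB.Mono 12 12 ⊕ BB.Mono 12 12 → ZMod 2)) hammingNorm)
    (hDZ : DZ.IsMinWeight BB.bb288.css.zSyndrome
      (BB.bb288.css.kerX : Set (BB.Mono 12 12 ⊕ BB.Mono 12 12 → ZMod 2)) hammingNorm)
    {p : ℝ} (hp0 : 0 ≤ p) (hp : p ≤ 3 / 4) (hr : 10 * Real.sqrt (2 * p / 3 * (1 - 2 * p / 3)) < 1) :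
    BB.bb288.css.depolarizingFailureProb DX DZ p ≤
      2 * ((288 : ℕ) * (10 * Real.sqrt (2 * p / 3 * (1 - 2 * p / 3))) ^ 18 /
        (5 * (1 - 10 * Real.sqrt (2 * p / 3 * (1 - 2 * p / 3))))) :=
  bb_depolarizingFailureProb_le_of_hasParams BB.bb288 BB.isBBPoly_bb288.1 BB.isBBPoly_bb288.2 h (by norm_num)
    hDX hDZ hp0 hp hr

end Summit.Ventures.QEC.Thresholds
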